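import Mathlib
import Literature.MathematicalPhysics.QuantumFieldTheory.Balaban1983to89.B5Prop11Lower

/-!
# B5 (1.2), (1.3), (1.4), (1.21) — the plaquette field, the action, gauge invariance and the
identity `⟨∂A, ∂A⟩ = Σ_μ ⟨A_μ, ΔA_μ⟩ − ⟨∂*A, ∂*A⟩` on the lattice torus, in the kernel

B5 = T. Bałaban, *Propagators and renormalization transformations for lattice gauge theories. I*,
Commun. Math. Phys. **95** (1984) 17–40 (`Balaban1984PropagatorsI`).  Seventh kernel pass on node
T02.1 (B5 Prop. 1.1) of the `pub-balaban` reconstruction.  Passes 4–6 (`B5Prop11Plancherel`,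
`B5Prop11Inverse`, `B5Prop11Lower`) work with the operator `Lap := Σ_ν ∇_ν^* ∇_ν` on
`ℓ²(T_η; ℂ^d)` and READ it as the `Δ` of (1.90) through B5's sentence «Δ = ∂*∂ + ∂∂*» ((1.69))
and (1.21); pass 6 lists as NOT certified «the lattice identity ∂*∂ + ∂∂* = Σ_ν ∇_ν^*∇_ν ⊗ 1
behind Δ = ∂*∂ + ∂∂*».  This module types the position-space objects of B5 §1 — components
`A_μ(x)` (1.1), the plaquette field `F_{μν}` (1.2), the action (1.3), gauge transformations (1.4),
the divergence `∂*A = Σ_μ ∂_μ^* A_μ` and the scalar lattice Laplacian `Δ` of (1.21) — on the torus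
`Π_μ ℤ/N_μ` and proves in the kernel, with zero `sorry`: every printed equality of (1.21), the last
equality of (1.3), the antisymmetry in (1.2), the gauge invariance of `∂A` and of the action
asserted after (1.3), and the identification of the scalar `Δ` of (1.21), acting componentwise,
with the vector-index operator `Σ_ν ∇_ν^*∇_ν` of passes 4–6 (`form_LapV`, `Lap_eq_LapV`), so that
(1.21) reads `⟨∂A, ∂A⟩ = ⟨A, (Σ_ν ∇_ν^*∇_ν − ∂∂*) A⟩` (`form_curl_eq`), and, by polarization, the
OPERATOR identity `(∂)^*∂ = 2·(Σ_ν ∇_ν^*∇_ν − ∂∂^*)` for the plaquette-field operator `∂ = CurlOp`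
indexed by ordered pairs (`curl_adjoint_curl`) — the lattice «Δ = ∂*∂ + ∂∂*» of (1.69) on vector
functions, with the factor `2` = B5's `½ Σ` over ordered pairs in (1.21).

## The printed text (verbatim)

B5 p. 18: «We denote them by b, b′, c, or ⟨x, x′⟩, ⟨x, x + εe_μ⟩. Thus A are functions
A: {b ⊂ T_ε} → ℝ. We identify them with vector valued functions defined on T_ε by the formula
   A_{⟨x,x+εe_μ⟩} = A(x, x + εe_μ) = A_μ(x), x ∈ T_ε, μ = 1, …, d.   (1.1)
… If p is a plaquette p = ⟨x, y, z, w⟩, where x, y, z, w are corners of the square p written in an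
order indicated by the orientation of p, then we define a plaquette variable
   F(p) = (∂A)(p) = ε⁻¹A(∂p) = ε⁻¹(A(x, y) + A(y, z) + A(z, w) + A(w, x))
        = (∂_μA_ν)(x) − (∂_νA_μ)(x) = F_{μν}(x) = −F_{νμ}(x).   (1.2)
The last equalities hold if we identify p with ⟨x, x + εe_μ, x + εe_μ + εe_ν, x + εe_ν⟩ for some
μ < ν. … We assume that A_b is defined for bonds b with arbitrary orientation and that
A_{⟨x,x′⟩} = −A_{⟨x′,x⟩}. The action is defined by the quadratic form
   S^ε(A) = ½ Σ_{p⊂T_ε} ε^d|F(p)|² = ½ Σ_{p⊂T_ε} ε^d|(∂A)(p)|² = ¼ Σ_{x∈T_ε,μ,ν} ε^d|F_{μν}(x)|².   (1.3)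
The covariant derivative ∂A, and so the action above, are invariant with respect to a group of
guage transformations. A guage transformation is determined by a real valued function λ : T_ε → ℝ,
and is defined by
   A^λ_b = A_b − (∂λ)(b), (∂λ)(b) = ε⁻¹(λ(b₊) − λ(b₋)), b = ⟨b₋, b₊⟩.   (1.4)»
B5 p. 21: «The action can be written as
   ⟨∂A, ∂A⟩ = ½ Σ_{x∈T_η,μ,ν} η^d|F_{μν}(x)|² = Σ_{x,μ,ν} η^d|(∂_μA_ν)(x)|²
             − Σ_{x,μ,ν} η^d(∂_μA_ν)(x)(∂_νA_μ)(x) = Σ_μ ⟨∂A_μ, ∂A_μ⟩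
             − Σ_x η^d|Σ_μ(∂*_μA_μ)(x)|² = Σ_μ ⟨A_μ, ΔA_μ⟩ − ⟨∂*A, ∂*A⟩,   (1.21)
where Δ is η-lattice Laplace operator for scalar functions and ∂* is the divergence operator for
vector functions, ∂*A = Σ_μ ∂*_μA_μ.»
B5 p. 29 (quoted in full in `B5Prop11Lower`): «⟨A, Δ_a A⟩ = ⟨A, ∂*∂A⟩ + ⟨A, ∂R∂*A⟩ + a⟨A, Q*QA⟩
= ⟨A, ΔA⟩ − ⟨A, ∂P∂*A⟩ + a⟨A, Q*QA⟩, Δ = ∂*∂ + ∂∂*, R = I − P,» ((1.69)).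

## Dictionary

Sites `x ∈ T` = `Tor N = Π_μ ℤ/N_μ` (pass 4); `e_ν` = `unitVec N ν`; a vector field is
`A : Tor N × Fin d → ℂ` with components `comp N A μ = A_μ` ((1.1); the index `(x, μ)` is the
positively oriented bond `⟨x, x + εe_μ⟩`); the lattice factor `ε⁻¹` (resp. `η⁻¹`) is a parameter
`c : ℂ`; `sdiff N c ν = ∂_ν`, `(∂_ν f)(x) = c (f(x + e_ν) − f(x))` on scalar functions ((1.4) for
the bond `⟨x, x + εe_ν⟩`), `(sdiff N c ν)ᴴ = ∂_ν^*` its adjoint; `pd N c A μ ν = ∂_μ A_ν`;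
`Fs N c A μ ν x = F_{μν}(x)` ((1.2)); `divS N c A = ∂*A = Σ_μ ∂_μ^* A_μ`; `LapS N c = Δ = Σ_ν ∂_ν^*∂_ν`
(the `Δ` of (1.21): the scalar lattice Laplace operator for which `⟨∂f, ∂f⟩ = ⟨f, Δf⟩`);
`GradOp N c = ∂` on scalar functions (`(∂λ)(⟨x, x+e_ν⟩) = (∂_νλ)(x)`), `(GradOp N c)ᴴ = ∂*`;
`gaugeT N c A λ = A^λ` ((1.4)); `actionS N c w A = S^ε(A)` with the weight `w = ε^d` ((1.3), the
plaquettes of the torus being the `(x, μ, ν)` with `μ < ν`); `ipw w f g = Σ_x w \bar f(x) g(x)`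
(weight `w = η^d`; B5's fields are real, and for real fields every `conj` below is the identity);
`LapV N c = Σ_ν ∇_ν^*∇_ν` with `∇_ν = fdiff N c ν` the componentwise forward difference of pass 4,
and `B5Prop11Lower.Lap n M = LapV (fine n M) n` (`Lap_eq_LapV`, by `rfl`).

## What is certified (zero `sorry`)

* `Fs_apply` ((1.2): `F_{μν}(x) = ε⁻¹(A(x,y) + A(y,z) + A(z,w) + A(w,x))` for
  `p = ⟨x, x+εe_μ, x+εe_μ+εe_ν, x+εe_ν⟩`, with `A(z,w) = −A_μ(x+εe_ν)`, `A(w,x) = −A_ν(x)` by the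
  orientation rule `A_{⟨x,x′⟩} = −A_{⟨x′,x⟩}`), `Fs_antisymm` (`F_{μν} = −F_{νμ}`), `Fs_self`;
* `actionS_eq_quarter` (the last equality of (1.3): `½ Σ_p ε^d|F(p)|² = ¼ Σ_{x,μ,ν} ε^d|F_{μν}(x)|²`);
* `Fs_gaugeT`, `actionS_gaugeT` («The covariant derivative ∂A, and so the action above, are
  invariant» under (1.4)), via `sdiff_sdiff_comm` (`∂_μ∂_ν = ∂_ν∂_μ`);
* (1.21), equality by equality, for every complex vector field `A`, every torus `N`, every `c`:
  `half_sum_Fs_sq_eq` (first `=`), `sum_sq_pd_eq_sum_form_grad` and `cross_eq_nsq_divS`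
  (second `=`: `Σ|∂_μA_ν|² = Σ_μ⟨∂A_μ, ∂A_μ⟩` and the cross term `= Σ_x|Σ_μ(∂*_μA_μ)(x)|²`, the
  latter by the commutation `∂_μ^*∂_ν = ∂_ν∂_μ^*`, `sdiffH_sdiff_comm`), `form_grad_eq_form_LapS`
  and `nsq_divS_eq` (third `=`), assembled in **`action_identity_121`**:
  `½ Σ_{x,μ,ν}|F_{μν}(x)|² = Σ_μ ⟨A_μ, ΔA_μ⟩ − ⟨∂*A, ∂*A⟩`, and with the weights `η^d` displayed,
  `action_identity_121_weighted`;
* the link to passes 4–6: `fdiff_mulVec_apply` (`(∇_ν A)_κ = ∂_ν A_κ`), `form_LapV`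
  (`⟨A, Σ_ν∇_ν^*∇_ν A⟩ = Σ_κ ⟨A_κ, ΔA_κ⟩`), `Lap_eq_LapV`, `form_Lap`, `GradOp_conjTranspose_mulVec`
  (`∂* = (GradOp)ᴴ`), **`form_curl_eq`**: `½ Σ_{x,μ,ν}|F_{μν}(x)|² = ⟨A, (Σ_ν∇_ν^*∇_ν − ∂∂*)A⟩`,
  `form_curl_nonneg`, and the operator form **`curl_adjoint_curl`**:
  `(CurlOp)ᴴ CurlOp = 2·(Σ_ν∇_ν^*∇_ν − GradOp GradOpᴴ)` (`CurlOp_mulVec`: `(CurlOp A)(x,(μ,ν)) =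
  F_{μν}(x)`; `ext_of_form_eq`: polarization), i.e. «Δ = ∂*∂ + ∂∂*» ((1.69)) for vector functions
  with `Δ = Σ_ν∇_ν^*∇_ν` componentwise — the identity listed NOT certified in pass 6.

## What is NOT certified here (stated, not smuggled)

* B5's `2`-form calculus is not developed beyond what (1.2)/(1.3)/(1.21) display.  B5's `∂*` on
  plaquette functions is the adjoint of `∂` for the scalar product `Σ_p η^d F(p)F′(p)` over
  plaquettes `μ < ν`; our `CurlOp` is indexed by ORDERED pairs, so `(CurlOp)ᴴ CurlOp = 2∂*∂` and
  `curl_adjoint_curl` is «∂*∂ = Δ − ∂∂*» up to this bookkeeping factor, which is exactly B5's `½`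
  in (1.21).  The operator `P`, the averages `Q_k`, `Q′_k` and the rest of (1.69) are untouched
  (see the NOT-certified lists of passes 5–6); that `calDa` of pass 5 IS the position-space
  `Δ − ∂P∂* + aQ*Q` remains uncertified.
* The first two members of (1.3)/(1.21) (`Σ` over plaquettes `p ⊂ T`) are typed with the plaquettes
  of the torus ENUMERATED as `(x, μ, ν)`, `μ < ν` (B5: «if we identify p with ⟨x, x + εe_μ, x + εe_μ
  + εe_ν, x + εe_ν⟩ for some μ < ν»); no independent combinatorial type of plaquettes is introduced
  (the foundations file `Setup.lean` has one, `Plaq`, over its own site type).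
* Fields are complex-valued here (B5: real); the printed product `(∂_μA_ν)(x)(∂_νA_μ)(x)` is typed
  as `conj((∂_μA_ν)(x))·(∂_νA_μ)(x)`, which is the printed expression for real `A` and real `c`.

Value: kernel certificates of the printed identities (1.2), (1.3), (1.21) and of the gauge
invariance sentence after (1.3), and the identification of the `Δ` of (1.21) with the operator
`Lap` of passes 4–6 — NOT summit progress.
-/

open scoped BigOperators Matrix ComplexConjugate ComplexOrder Matrix.Norms.L2Operator
open Finset Complex

namespace Literature.MathematicalPhysics.QuantumFieldTheory.Balaban1983to89.B5Action121

open Literature.MathematicalPhysics.QuantumFieldTheory.Balaban1983to89.B5Prop11Plancherel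
open Literature.MathematicalPhysics.QuantumFieldTheory.Balaban1983to89.B5Prop11Lower

noncomputable section

/-! ## §1 `ℓ²` bookkeeping -/

section VecTools

variable {m k : Type*} [Fintype m] [Fintype k]

/-- `(Xu)^* w = u^* (X^* w)`. [folklore] -/
theorem star_mulVec_dotProduct (X : Matrix k m ℂ) (u : m → ℂ) (w : k → ℂ) :
    star (X *ᵥ u) ⬝ᵥ w = star u ⬝ᵥ (Xᴴ *ᵥ w) := by
  rw [Matrix.star_mulVec, Matrix.dotProduct_mulVec]

/-- `u^* (X w) = (X^* u)^* w`. [folklore] -/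
theorem dotProduct_mulVec_eq_star_conjTranspose_mulVec (X : Matrix m k ℂ) (u : m → ℂ)
    (w : k → ℂ) : star u ⬝ᵥ (X *ᵥ w) = star (Xᴴ *ᵥ u) ⬝ᵥ w := by
  rw [star_mulVec_dotProduct, Matrix.conjTranspose_conjTranspose]

/-- `x^* (V^* V) x = (Vx)^* (Vx)` for a rectangular `V`. [folklore] -/
theorem form_gram_rect (V : Matrix k m ℂ) (x : m → ℂ) :
    star x ⬝ᵥ ((Vᴴ * V) *ᵥ x) = star (V *ᵥ x) ⬝ᵥ (V *ᵥ x) := by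
  rw [← Matrix.mulVec_mulVec, star_mulVec_dotProduct]

/-- polarization: two matrices with the same quadratic form `x ↦ x^* M x` on `ℂ^m` are equal.
[folklore] -/
theorem ext_of_form_eq [DecidableEq m] {M₁ M₂ : Matrix m m ℂ}
    (h : ∀ x : m → ℂ, star x ⬝ᵥ (M₁ *ᵥ x) = star x ⬝ᵥ (M₂ *ᵥ x)) : M₁ = M₂ := by
  rw [← sub_eq_zero]
  set M := M₁ - M₂ with hM
  have hQ : ∀ x : m → ℂ, star x ⬝ᵥ (M *ᵥ x) = 0 := by
    intro x
    rw [hM, Matrix.sub_mulVec, dotProduct_sub, h x, sub_self]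
  have hB : ∀ x y : m → ℂ, star x ⬝ᵥ (M *ᵥ y) = 0 := by
    intro x y
    have e1 := hQ (x + y)
    have e2 := hQ (x + Complex.I • y)
    simp only [Matrix.mulVec_add, Matrix.mulVec_smul, star_add, star_smul, add_dotProduct,
      dotProduct_add, smul_dotProduct, dotProduct_smul, smul_eq_mul, Complex.star_def,
      Complex.conj_I, hQ x, hQ y, zero_add, add_zero] at e1 e2
    have e3 : star x ⬝ᵥ (M *ᵥ y) - star y ⬝ᵥ (M *ᵥ x) = 0 := by
      apply mul_left_cancel₀ Complex.I_ne_zero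
      linear_combination e2
    linear_combination (e1 + e3) / 2
  have hx : ∀ i : m, star (Pi.single i 1 : m → ℂ) = (Pi.single i 1 : m → ℂ) := by
    intro i
    ext l
    by_cases hl : l = i
    · subst hl; simp
    · simp [Pi.single_eq_of_ne hl]
  have hcol : ∀ j : m, M *ᵥ (Pi.single j 1 : m → ℂ) = fun l => M l j := by
    intro j
    funext l
    simp [Matrix.mulVec, dotProduct, Pi.single_apply]
  ext i j
  have h0 := hB (Pi.single i 1 : m → ℂ) (Pi.single j 1 : m → ℂ)
  rw [hx i, hcol j] at h0
  simpa using h0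

/-- a triple sum `Σ_x Σ_μ Σ_ν` reordered as `Σ_μ Σ_ν Σ_x`. [folklore] -/
theorem sum3_comm {α β γ M : Type*} [Fintype α] [Fintype β] [Fintype γ] [AddCommMonoid M]
    (f : α → β → γ → M) :
    ∑ x, ∑ μ, ∑ ν, f x μ ν = ∑ μ, ∑ ν, ∑ x, f x μ ν := by
  rw [Finset.sum_comm]
  exact Finset.sum_congr rfl fun μ _ => Finset.sum_comm

end VecTools

/-! ## §2 Scalar lattice calculus on the torus: `∂_ν`, `∂_ν^*`, their commutation -/

section Scalar

variable {d : ℕ} (N : Fin d → ℕ) [hN : ∀ μ, NeZero (N μ)]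

/-- the translation `(S_ν f)(x) = f(x + e_ν)` of scalar lattice functions. [folklore] -/
def shiftS (ν : Fin d) : Matrix (Tor N) (Tor N) ℂ :=
  fun x y => if y = x + unitVec N ν then 1 else 0

/-- the forward difference `(∂_ν f)(x) = c (f(x + e_ν) − f(x))` with lattice factor `c = ε⁻¹`:
(1.4) «(∂λ)(b) = ε⁻¹(λ(b₊) − λ(b₋)), b = ⟨b₋, b₊⟩» for the bond `b = ⟨x, x + εe_ν⟩`.
[cite: Balaban1984PropagatorsI, (1.4) p.18] -/
def sdiff (c : ℂ) (ν : Fin d) : Matrix (Tor N) (Tor N) ℂ :=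
  c • (shiftS N ν - 1)

/-- `(S_ν f)(x) = f(x + e_ν)`. [folklore] -/
theorem shiftS_mulVec (ν : Fin d) (f : Tor N → ℂ) (x : Tor N) :
    (shiftS N ν *ᵥ f) x = f (x + unitVec N ν) := by
  simp [Matrix.mulVec, dotProduct, shiftS]

omit hN in
/-- entries of `S_ν^*`: the translation by `−e_ν`. [folklore] -/
theorem shiftS_conjTranspose_apply (ν : Fin d) (x y : Tor N) :
    (shiftS N ν)ᴴ x y = if y = x - unitVec N ν then 1 else 0 := by
  rw [Matrix.conjTranspose_apply, shiftS]
  have h : (x = y + unitVec N ν) ↔ (y = x - unitVec N ν) := by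
    constructor
    · intro h'; rw [h', add_sub_cancel_right]
    · intro h'; rw [h', sub_add_cancel]
  by_cases hy : y = x - unitVec N ν
  · rw [if_pos hy, if_pos (h.mpr hy), star_one]
  · rw [if_neg hy, if_neg (fun h' => hy (h.mp h')), star_zero]

/-- `(S_ν^* f)(x) = f(x − e_ν)`. [folklore] -/
theorem shiftS_conjTranspose_mulVec (ν : Fin d) (f : Tor N → ℂ) (x : Tor N) :
    ((shiftS N ν)ᴴ *ᵥ f) x = f (x - unitVec N ν) := by
  simp only [Matrix.mulVec, dotProduct, shiftS_conjTranspose_apply, boole_mul,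
    Finset.sum_ite_eq', Finset.mem_univ, if_true]

/-- `(∂_ν f)(x) = c (f(x + e_ν) − f(x))`. [cite: Balaban1984PropagatorsI, (1.4) p.18] -/
theorem sdiff_mulVec (c : ℂ) (ν : Fin d) (f : Tor N → ℂ) (x : Tor N) :
    (sdiff N c ν *ᵥ f) x = c * (f (x + unitVec N ν) - f x) := by
  simp only [sdiff, Matrix.smul_mulVec, Matrix.sub_mulVec, Matrix.one_mulVec, Pi.smul_apply,
    Pi.sub_apply, shiftS_mulVec, smul_eq_mul]

/-- the adjoint `(∂_ν^* f)(x) = \bar c (f(x − e_ν) − f(x))`. [folklore] -/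
theorem sdiff_conjTranspose_mulVec (c : ℂ) (ν : Fin d) (f : Tor N → ℂ) (x : Tor N) :
    ((sdiff N c ν)ᴴ *ᵥ f) x = conj c * (f (x - unitVec N ν) - f x) := by
  simp only [sdiff, Matrix.conjTranspose_smul, Matrix.conjTranspose_sub,
    Matrix.conjTranspose_one, Matrix.smul_mulVec, Matrix.sub_mulVec, Matrix.one_mulVec,
    Pi.smul_apply, Pi.sub_apply, shiftS_conjTranspose_mulVec, smul_eq_mul, Complex.star_def]

/-- forward differences commute: `∂_μ ∂_ν = ∂_ν ∂_μ`. [folklore] -/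
theorem sdiff_sdiff_comm (c : ℂ) (μ ν : Fin d) (f : Tor N → ℂ) :
    sdiff N c μ *ᵥ (sdiff N c ν *ᵥ f) = sdiff N c ν *ᵥ (sdiff N c μ *ᵥ f) := by
  funext x
  simp only [sdiff_mulVec]
  rw [add_right_comm x (unitVec N μ) (unitVec N ν)]
  ring

/-- `∂_μ^* ∂_ν = ∂_ν ∂_μ^*` (lattice translations commute with their adjoints). [folklore] -/
theorem sdiffH_sdiff_comm (c : ℂ) (μ ν : Fin d) (f : Tor N → ℂ) :
    (sdiff N c μ)ᴴ *ᵥ (sdiff N c ν *ᵥ f) = sdiff N c ν *ᵥ ((sdiff N c μ)ᴴ *ᵥ f) := by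
  funext x
  simp only [sdiff_mulVec, sdiff_conjTranspose_mulVec]
  rw [sub_add_eq_add_sub x (unitVec N μ) (unitVec N ν)]
  ring

/-- the `Δ` of (1.21): «Δ is η-lattice Laplace operator for scalar functions», the operator with
`⟨∂f, ∂f⟩ = ⟨f, Δf⟩`, i.e. `Δ = Σ_ν ∂_ν^* ∂_ν`. [cite: Balaban1984PropagatorsI, (1.21) p.21] -/
def LapS (c : ℂ) : Matrix (Tor N) (Tor N) ℂ :=
  ∑ ν, (sdiff N c ν)ᴴ * sdiff N c ν

/-- `(Δf)(x) = Σ_ν |c|² (2f(x) − f(x + e_ν) − f(x − e_ν))`. [folklore] -/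
theorem LapS_mulVec (c : ℂ) (f : Tor N → ℂ) (x : Tor N) :
    (LapS N c *ᵥ f) x = ∑ ν, conj c * c * (2 * f x - f (x + unitVec N ν) - f (x - unitVec N ν)) := by
  simp only [LapS, Matrix.sum_mulVec, Finset.sum_apply, ← Matrix.mulVec_mulVec,
    sdiff_conjTranspose_mulVec, sdiff_mulVec, sub_add_cancel]
  refine Finset.sum_congr rfl fun ν _ => ?_
  ring

/-- the gradient `∂` from scalar to vector functions: `(∂λ)(⟨x, x + εe_ν⟩) = (∂_ν λ)(x)` ((1.4)).
[cite: Balaban1984PropagatorsI, (1.4) p.18] -/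
def GradOp (c : ℂ) : Matrix (Tor N × Fin d) (Tor N) ℂ :=
  fun i y => sdiff N c i.2 i.1 y

/-- `(∂λ)_ν(x) = (∂_ν λ)(x)`. [folklore] -/
theorem GradOp_mulVec (c : ℂ) (l : Tor N → ℂ) (x : Tor N) (ν : Fin d) :
    (GradOp N c *ᵥ l) (x, ν) = (sdiff N c ν *ᵥ l) x := rfl

/-- `∂^*∂ = Δ` on scalar functions: `⟨∂f, ∂f⟩ = ⟨f, Δf⟩`. [folklore] -/
theorem GradOp_conjTranspose_mul_GradOp (c : ℂ) :
    (GradOp N c)ᴴ * GradOp N c = LapS N c := by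
  ext x y
  simp only [Matrix.mul_apply, Matrix.conjTranspose_apply, GradOp, LapS, Matrix.sum_apply,
    Fintype.sum_prod_type]
  rw [Finset.sum_comm]

/-- the weighted scalar product `⟨f, g⟩ = Σ_x w \bar f(x) g(x)` (weight `w = η^d` on `T_η`, as
displayed in (1.21)). [folklore] -/
def ipw (w : ℝ) (f g : Tor N → ℂ) : ℂ := (w : ℂ) * (star f ⬝ᵥ g)

end Scalar

/-! ## §3 Vector fields: components (1.1), the plaquette field (1.2), divergence, gauge
transformations (1.4), the action (1.3) -/

section Vector

variable {d : ℕ} (N : Fin d → ℕ) [hN : ∀ μ, NeZero (N μ)]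

/-- (1.1) the components `A_μ(x) = A(x, x + εe_μ)` of a vector field (a function on positively
oriented bonds `(x, μ) = ⟨x, x + εe_μ⟩`). [cite: Balaban1984PropagatorsI, (1.1) p.18] -/
def comp (A : Tor N × Fin d → ℂ) (κ : Fin d) : Tor N → ℂ := fun x => A (x, κ)

/-- `(S_ν A)_κ(x) = A_κ(x + e_ν)` for the vector-index translation of pass 4. [folklore] -/
theorem shiftM_mulVec (ν : Fin d) (A : Tor N × Fin d → ℂ) (x : Tor N) (κ : Fin d) :
    (shiftM N ν *ᵥ A) (x, κ) = A (x + unitVec N ν, κ) := by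
  simp [Matrix.mulVec, dotProduct, shiftM]

/-- the vector-index forward difference of pass 4 acts componentwise: `(∇_ν A)_κ = ∂_ν A_κ`.
[folklore] -/
theorem fdiff_mulVec_apply (c : ℂ) (ν : Fin d) (A : Tor N × Fin d → ℂ) (x : Tor N) (κ : Fin d) :
    (fdiff N c ν *ᵥ A) (x, κ) = (sdiff N c ν *ᵥ comp N A κ) x := by
  rw [sdiff_mulVec]
  simp only [fdiff, Matrix.smul_mulVec, Matrix.sub_mulVec, Matrix.one_mulVec, Pi.smul_apply,
    Pi.sub_apply, shiftM_mulVec, smul_eq_mul, comp]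

/-- `(∂_μ A_ν)(x)`. [folklore] -/
def pd (c : ℂ) (A : Tor N × Fin d → ℂ) (μ ν : Fin d) : Tor N → ℂ :=
  sdiff N c μ *ᵥ comp N A ν

/-- (1.2) the plaquette field `F_{μν}(x) = (∂_μA_ν)(x) − (∂_νA_μ)(x)`.
[cite: Balaban1984PropagatorsI, (1.2) p.18] -/
def Fs (c : ℂ) (A : Tor N × Fin d → ℂ) (μ ν : Fin d) : Tor N → ℂ :=
  fun x => pd N c A μ ν x - pd N c A ν μ x

/-- (1.2): `F(p) = ε⁻¹(A(x,y) + A(y,z) + A(z,w) + A(w,x))` for `p = ⟨x, x+εe_μ, x+εe_μ+εe_ν, x+εe_ν⟩`,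
with `A(x,y) = A_μ(x)`, `A(y,z) = A_ν(x+εe_μ)`, `A(z,w) = −A_μ(x+εe_ν)`, `A(w,x) = −A_ν(x)` by
«A_{⟨x,x′⟩} = −A_{⟨x′,x⟩}». [cite: Balaban1984PropagatorsI, (1.2) p.18] -/
theorem Fs_apply (c : ℂ) (A : Tor N × Fin d → ℂ) (μ ν : Fin d) (x : Tor N) :
    Fs N c A μ ν x
      = c * (A (x, μ) + A (x + unitVec N μ, ν) - A (x + unitVec N ν, μ) - A (x, ν)) := by
  simp only [Fs, pd, sdiff_mulVec, comp]
  ring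

/-- (1.2): `F_{μν}(x) = −F_{νμ}(x)`. [cite: Balaban1984PropagatorsI, (1.2) p.18] -/
theorem Fs_antisymm (c : ℂ) (A : Tor N × Fin d → ℂ) (μ ν : Fin d) (x : Tor N) :
    Fs N c A μ ν x = -Fs N c A ν μ x := by
  simp only [Fs]
  ring

/-- `F_{μμ} = 0`. [folklore] -/
theorem Fs_self (c : ℂ) (A : Tor N × Fin d → ℂ) (μ : Fin d) (x : Tor N) :
    Fs N c A μ μ x = 0 := by
  simp only [Fs, sub_self]

/-- the divergence `∂*A = Σ_μ ∂_μ^* A_μ` of (1.21) («∂* is the divergence operator for vector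
functions, ∂*A = Σ_μ ∂*_μA_μ»). [cite: Balaban1984PropagatorsI, (1.21) p.21] -/
def divS (c : ℂ) (A : Tor N × Fin d → ℂ) : Tor N → ℂ :=
  ∑ μ, (sdiff N c μ)ᴴ *ᵥ comp N A μ

/-- `(∂*A)(x) = Σ_μ \bar c (A_μ(x − e_μ) − A_μ(x))`. [folklore] -/
theorem divS_apply (c : ℂ) (A : Tor N × Fin d → ℂ) (x : Tor N) :
    divS N c A x = ∑ μ, conj c * (A (x - unitVec N μ, μ) - A (x, μ)) := by
  simp only [divS, Finset.sum_apply, sdiff_conjTranspose_mulVec, comp]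

/-- `∂* = (∂)^*`: the divergence is the adjoint of the gradient. [folklore] -/
theorem GradOp_conjTranspose_mulVec (c : ℂ) (A : Tor N × Fin d → ℂ) (y : Tor N) :
    ((GradOp N c)ᴴ *ᵥ A) y = divS N c A y := by
  simp only [Matrix.mulVec, dotProduct, Matrix.conjTranspose_apply, GradOp, divS,
    Finset.sum_apply, Fintype.sum_prod_type, comp]
  rw [Finset.sum_comm]

/-- `(∂)^* A = ∂*A` as functions. [folklore] -/
theorem GradOp_conjTranspose_mulVec_eq (c : ℂ) (A : Tor N × Fin d → ℂ) :
    (GradOp N c)ᴴ *ᵥ A = divS N c A :=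
  funext fun y => GradOp_conjTranspose_mulVec N c A y

/-- (1.4) the gauge transformation `A^λ_b = A_b − (∂λ)(b)`. [cite: Balaban1984PropagatorsI, (1.4) p.18] -/
def gaugeT (c : ℂ) (A : Tor N × Fin d → ℂ) (l : Tor N → ℂ) : Tor N × Fin d → ℂ :=
  A - GradOp N c *ᵥ l

/-- «The covariant derivative ∂A … [is] invariant»: `F_{μν}(A^λ) = F_{μν}(A)` (because
`∂_μ∂_νλ = ∂_ν∂_μλ`). [cite: Balaban1984PropagatorsI, (1.4) p.18] -/
theorem Fs_gaugeT (c : ℂ) (A : Tor N × Fin d → ℂ) (l : Tor N → ℂ) (μ ν : Fin d) (x : Tor N) :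
    Fs N c (gaugeT N c A l) μ ν x = Fs N c A μ ν x := by
  simp only [Fs_apply, gaugeT, Pi.sub_apply, GradOp_mulVec, sdiff_mulVec]
  rw [add_right_comm x (unitVec N ν) (unitVec N μ)]
  ring

/-- (1.3) the action `S^ε(A) = ½ Σ_{p⊂T_ε} ε^d |F(p)|²`, the plaquettes of the torus being
`p = ⟨x, x+εe_μ, x+εe_μ+εe_ν, x+εe_ν⟩`, `x ∈ T`, `μ < ν`; the weight `ε^d` is the parameter `w`.
[cite: Balaban1984PropagatorsI, (1.3) p.18] -/
def actionS (c : ℂ) (w : ℝ) (A : Tor N × Fin d → ℂ) : ℝ :=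
  (1 / 2) * ∑ x, ∑ μ, ∑ ν, if μ < ν then w * ‖Fs N c A μ ν x‖ ^ 2 else 0

/-- (1.3), last equality: `½ Σ_{p⊂T_ε} ε^d|F(p)|² = ¼ Σ_{x∈T_ε,μ,ν} ε^d|F_{μν}(x)|²`.
[cite: Balaban1984PropagatorsI, (1.3) p.18] -/
theorem actionS_eq_quarter (c : ℂ) (w : ℝ) (A : Tor N × Fin d → ℂ) :
    actionS N c w A = (1 / 4) * ∑ x, ∑ μ, ∑ ν, w * ‖Fs N c A μ ν x‖ ^ 2 := by
  unfold actionS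
  have key : ∀ x : Tor N,
      ∑ μ, ∑ ν, w * ‖Fs N c A μ ν x‖ ^ 2
        = 2 * ∑ μ, ∑ ν, (if μ < ν then w * ‖Fs N c A μ ν x‖ ^ 2 else 0) := by
    intro x
    set g : Fin d → Fin d → ℝ := fun μ ν => w * ‖Fs N c A μ ν x‖ ^ 2 with hg
    have gsymm : ∀ μ ν, g μ ν = g ν μ := by
      intro μ ν
      simp only [hg, Fs_antisymm N c A μ ν x, norm_neg]
    have gdiag : ∀ μ, g μ μ = 0 := by
      intro μ
      simp only [hg, Fs_self, norm_zero]
      ring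
    have tri : ∀ μ ν, g μ ν
        = (if μ < ν then g μ ν else 0) + (if ν < μ then g μ ν else 0)
          + (if μ = ν then g μ ν else 0) := by
      intro μ ν
      rcases lt_trichotomy μ ν with h | h | h
      · simp [h, h.ne, lt_asymm h]
      · subst h; simp
      · simp [h, h.ne', lt_asymm h]
    have h1 : ∑ μ, ∑ ν, (if ν < μ then g μ ν else 0) = ∑ μ, ∑ ν, (if μ < ν then g μ ν else 0) := by
      rw [Finset.sum_comm]
      refine Finset.sum_congr rfl fun μ _ => Finset.sum_congr rfl fun ν _ => ?_
      rw [gsymm ν μ]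
    have h2 : ∑ μ, ∑ ν, (if μ = ν then g μ ν else 0) = (0 : ℝ) := by
      simp [Finset.sum_ite_eq, gdiag]
    change ∑ μ, ∑ ν, g μ ν = 2 * ∑ μ, ∑ ν, (if μ < ν then g μ ν else 0)
    calc ∑ μ, ∑ ν, g μ ν
        = ∑ μ, ∑ ν, ((if μ < ν then g μ ν else 0) + (if ν < μ then g μ ν else 0)
            + (if μ = ν then g μ ν else 0)) :=
          Finset.sum_congr rfl fun μ _ => Finset.sum_congr rfl fun ν _ => tri μ ν
      _ = ∑ μ, ∑ ν, (if μ < ν then g μ ν else 0) + ∑ μ, ∑ ν, (if ν < μ then g μ ν else 0)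
            + ∑ μ, ∑ ν, (if μ = ν then g μ ν else 0) := by
          simp only [Finset.sum_add_distrib]
      _ = 2 * ∑ μ, ∑ ν, (if μ < ν then g μ ν else 0) := by rw [h1, h2]; ring
  simp_rw [key, Finset.mul_sum]
  simp_rw [← Finset.mul_sum]
  ring

/-- the action is gauge invariant: `S^ε(A^λ) = S^ε(A)` («and so the action above»).
[cite: Balaban1984PropagatorsI, (1.4) p.18] -/
theorem actionS_gaugeT (c : ℂ) (w : ℝ) (A : Tor N × Fin d → ℂ) (l : Tor N → ℂ) :
    actionS N c w (gaugeT N c A l) = actionS N c w A := by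
  simp only [actionS, Fs_gaugeT]

/-- `2 S^ε(A) = ½ Σ_{x,μ,ν} ε^d|F_{μν}(x)|²` (the left member of (1.21) is `Σ_p η^d|F(p)|² = 2S^η(A)`).
[cite: Balaban1984PropagatorsI, (1.3) p.18] -/
theorem two_mul_actionS (c : ℂ) (w : ℝ) (A : Tor N × Fin d → ℂ) :
    2 * actionS N c w A = (1 / 2) * ∑ x, ∑ μ, ∑ ν, w * ‖Fs N c A μ ν x‖ ^ 2 := by
  rw [actionS_eq_quarter]
  ring

end Vector

/-! ## §4 The identity (1.21) -/

section Identity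

variable {d : ℕ} (N : Fin d → ℕ) [hN : ∀ μ, NeZero (N μ)]

/-- (1.21), first equality: `½ Σ_{x,μ,ν}|F_{μν}(x)|² = Σ_{x,μ,ν}|(∂_μA_ν)(x)|² −
Σ_{x,μ,ν} \overline{(∂_μA_ν)(x)}(∂_νA_μ)(x)`. [cite: Balaban1984PropagatorsI, (1.21) p.21] -/
theorem half_sum_Fs_sq_eq (c : ℂ) (A : Tor N × Fin d → ℂ) :
    ((((1 / 2 : ℝ) * ∑ x, ∑ μ, ∑ ν, ‖Fs N c A μ ν x‖ ^ 2 : ℝ)) : ℂ)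
      = ((∑ x, ∑ μ, ∑ ν, ‖pd N c A μ ν x‖ ^ 2 : ℝ) : ℂ)
        - ∑ x, ∑ μ, ∑ ν, conj (pd N c A μ ν x) * pd N c A ν μ x := by
  have hL : (∑ x, ∑ μ, ∑ ν, ‖Fs N c A μ ν x‖ ^ 2 : ℝ)
      = ∑ μ, ∑ ν, nsq (pd N c A μ ν - pd N c A ν μ) := by
    rw [sum3_comm]; rfl
  have hR : (∑ x, ∑ μ, ∑ ν, ‖pd N c A μ ν x‖ ^ 2 : ℝ) = ∑ μ, ∑ ν, nsq (pd N c A μ ν) := by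
    rw [sum3_comm]; rfl
  have hX : (∑ x, ∑ μ, ∑ ν, conj (pd N c A μ ν x) * pd N c A ν μ x)
      = ∑ μ, ∑ ν, star (pd N c A μ ν) ⬝ᵥ pd N c A ν μ := by
    rw [sum3_comm]; rfl
  rw [hL, hR, hX]
  push_cast
  simp_rw [← star_dotProduct_self, star_sub, sub_dotProduct, dotProduct_sub]
  have h1 : ∑ μ, ∑ ν, star (pd N c A ν μ) ⬝ᵥ pd N c A ν μ
      = ∑ μ, ∑ ν, star (pd N c A μ ν) ⬝ᵥ pd N c A μ ν := Finset.sum_comm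
  have h2 : ∑ μ, ∑ ν, star (pd N c A ν μ) ⬝ᵥ pd N c A μ ν
      = ∑ μ, ∑ ν, star (pd N c A μ ν) ⬝ᵥ pd N c A ν μ := Finset.sum_comm
  simp only [Finset.sum_sub_distrib, h1, h2]
  ring

/-- (1.21), the cross term: `Σ_{x,μ,ν} \overline{(∂_μA_ν)(x)}(∂_νA_μ)(x) = Σ_x |Σ_μ (∂*_μA_μ)(x)|²`
(by `∂_μ^*∂_ν = ∂_ν∂_μ^*`). [cite: Balaban1984PropagatorsI, (1.21) p.21] -/
theorem cross_eq_nsq_divS (c : ℂ) (A : Tor N × Fin d → ℂ) :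
    (∑ x, ∑ μ, ∑ ν, conj (pd N c A μ ν x) * pd N c A ν μ x)
      = ((∑ x, ‖divS N c A x‖ ^ 2 : ℝ) : ℂ) := by
  have hX : (∑ x, ∑ μ, ∑ ν, conj (pd N c A μ ν x) * pd N c A ν μ x)
      = ∑ μ, ∑ ν, star (pd N c A μ ν) ⬝ᵥ pd N c A ν μ := by
    rw [sum3_comm]; rfl
  have hterm : ∀ μ ν, star (pd N c A μ ν) ⬝ᵥ pd N c A ν μ
      = star ((sdiff N c ν)ᴴ *ᵥ comp N A ν) ⬝ᵥ ((sdiff N c μ)ᴴ *ᵥ comp N A μ) := by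
    intro μ ν
    simp only [pd]
    rw [star_mulVec_dotProduct, sdiffH_sdiff_comm,
      dotProduct_mulVec_eq_star_conjTranspose_mulVec]
  have hD : ((∑ x, ‖divS N c A x‖ ^ 2 : ℝ) : ℂ) = star (divS N c A) ⬝ᵥ divS N c A := by
    rw [star_dotProduct_self]; rfl
  rw [hX, hD]
  simp_rw [hterm]
  rw [divS, star_sum, dotProduct_sum]
  refine Finset.sum_congr rfl fun μ _ => ?_
  rw [sum_dotProduct]

/-- (1.21), the square term: `Σ_{x,μ,ν}|(∂_μA_ν)(x)|² = Σ_ν ⟨∂A_ν, ∂A_ν⟩` (the gradient of the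
component `A_ν`). [cite: Balaban1984PropagatorsI, (1.21) p.21] -/
theorem sum_sq_pd_eq_sum_form_grad (c : ℂ) (A : Tor N × Fin d → ℂ) :
    ((∑ x, ∑ μ, ∑ ν, ‖pd N c A μ ν x‖ ^ 2 : ℝ) : ℂ)
      = ∑ ν, star (GradOp N c *ᵥ comp N A ν) ⬝ᵥ (GradOp N c *ᵥ comp N A ν) := by
  have hR : (∑ x, ∑ μ, ∑ ν, ‖pd N c A μ ν x‖ ^ 2 : ℝ) = ∑ μ, ∑ ν, nsq (pd N c A μ ν) := by
    rw [sum3_comm]; rfl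
  rw [hR, Finset.sum_comm]
  push_cast
  refine Finset.sum_congr rfl fun ν _ => ?_
  rw [star_dotProduct_self, nsq, Fintype.sum_prod_type, Finset.sum_comm]
  push_cast
  refine Finset.sum_congr rfl fun κ _ => ?_
  rw [nsq]
  push_cast
  rfl

/-- `⟨∂f, ∂f⟩ = ⟨f, Δf⟩` for a scalar function. [folklore] -/
theorem form_grad_eq_form_LapS (c : ℂ) (f : Tor N → ℂ) :
    star (GradOp N c *ᵥ f) ⬝ᵥ (GradOp N c *ᵥ f) = star f ⬝ᵥ (LapS N c *ᵥ f) := by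
  rw [← form_gram_rect, GradOp_conjTranspose_mul_GradOp]

/-- `Σ_x |(∂*A)(x)|² = ⟨∂*A, ∂*A⟩`. [folklore] -/
theorem nsq_divS_eq (c : ℂ) (A : Tor N × Fin d → ℂ) :
    ((∑ x, ‖divS N c A x‖ ^ 2 : ℝ) : ℂ) = star (divS N c A) ⬝ᵥ divS N c A := by
  rw [star_dotProduct_self]; rfl

/-- **(1.21)**: `½ Σ_{x∈T,μ,ν}|F_{μν}(x)|² = Σ_μ ⟨A_μ, ΔA_μ⟩ − ⟨∂*A, ∂*A⟩` («where Δ is η-lattice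
Laplace operator for scalar functions and ∂* is the divergence operator for vector functions,
∂*A = Σ_μ ∂*_μA_μ»), unit weight. [cite: Balaban1984PropagatorsI, (1.21) p.21] -/
theorem action_identity_121 (c : ℂ) (A : Tor N × Fin d → ℂ) :
    ((((1 / 2 : ℝ) * ∑ x, ∑ μ, ∑ ν, ‖Fs N c A μ ν x‖ ^ 2 : ℝ)) : ℂ)
      = (∑ μ, star (comp N A μ) ⬝ᵥ (LapS N c *ᵥ comp N A μ))
        - star (divS N c A) ⬝ᵥ divS N c A := by
  rw [half_sum_Fs_sq_eq, cross_eq_nsq_divS, sum_sq_pd_eq_sum_form_grad, nsq_divS_eq]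
  simp_rw [form_grad_eq_form_LapS]

/-- **(1.21) with the weights `η^d` displayed**: `½ Σ_{x∈T_η,μ,ν} η^d|F_{μν}(x)|² =
Σ_μ ⟨A_μ, ΔA_μ⟩ − ⟨∂*A, ∂*A⟩`, `⟨f, g⟩ = Σ_x η^d \bar f(x) g(x)`.
[cite: Balaban1984PropagatorsI, (1.21) p.21] -/
theorem action_identity_121_weighted (c : ℂ) (w : ℝ) (A : Tor N × Fin d → ℂ) :
    ((((1 / 2 : ℝ) * ∑ x, ∑ μ, ∑ ν, w * ‖Fs N c A μ ν x‖ ^ 2 : ℝ)) : ℂ)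
      = (∑ μ, ipw N w (comp N A μ) (LapS N c *ᵥ comp N A μ))
        - ipw N w (divS N c A) (divS N c A) := by
  have h : ((1 / 2 : ℝ) * ∑ x, ∑ μ, ∑ ν, w * ‖Fs N c A μ ν x‖ ^ 2 : ℝ)
      = w * ((1 / 2 : ℝ) * ∑ x, ∑ μ, ∑ ν, ‖Fs N c A μ ν x‖ ^ 2) := by
    simp_rw [Finset.mul_sum]
    refine Finset.sum_congr rfl fun x _ => Finset.sum_congr rfl fun μ _ =>
      Finset.sum_congr rfl fun ν _ => ?_
    ring
  rw [h, Complex.ofReal_mul, action_identity_121]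
  simp only [ipw]
  rw [mul_sub, Finset.mul_sum]

/-- (1.21) and (1.3): `⟨∂A, ∂A⟩ := Σ_{p} η^d|F(p)|² = 2S^η(A) = Σ_μ ⟨A_μ, ΔA_μ⟩ − ⟨∂*A, ∂*A⟩`.
[cite: Balaban1984PropagatorsI, (1.21) p.21] -/
theorem two_actionS_eq (c : ℂ) (w : ℝ) (A : Tor N × Fin d → ℂ) :
    (((2 * actionS N c w A : ℝ)) : ℂ)
      = (∑ μ, ipw N w (comp N A μ) (LapS N c *ᵥ comp N A μ))
        - ipw N w (divS N c A) (divS N c A) := by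
  rw [two_mul_actionS, action_identity_121_weighted]

end Identity

/-! ## §5 The link to passes 4–6: `Σ_ν ∇_ν^*∇_ν` acts as `Δ` componentwise; `⟨∂A, ∂A⟩ =
⟨A, (Σ_ν ∇_ν^*∇_ν − ∂∂*)A⟩` -/

section Link

variable {d : ℕ} (N : Fin d → ℕ) [hN : ∀ μ, NeZero (N μ)]

/-- `Σ_ν ∇_ν^* ∇_ν` on vector fields, `∇_ν = fdiff N c ν` the componentwise forward difference of
pass 4 (for `N = fine n M`, `c = n` this is `B5Prop11Lower.Lap n M`). [folklore] -/
def LapV (c : ℂ) : Matrix (Tor N × Fin d) (Tor N × Fin d) ℂ :=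
  ∑ ν, (fdiff N c ν)ᴴ * fdiff N c ν

/-- `Σ_i |(∇_ν A)_i|² = Σ_κ Σ_x |(∂_ν A_κ)(x)|²`. [folklore] -/
theorem nsq_fdiff_mulVec (c : ℂ) (ν : Fin d) (A : Tor N × Fin d → ℂ) :
    nsq (fdiff N c ν *ᵥ A) = ∑ κ, nsq (sdiff N c ν *ᵥ comp N A κ) := by
  rw [nsq, Fintype.sum_prod_type, Finset.sum_comm]
  refine Finset.sum_congr rfl fun κ _ => Finset.sum_congr rfl fun x _ => ?_
  rw [fdiff_mulVec_apply]

/-- `⟨A, Σ_ν ∇_ν^*∇_ν A⟩ = Σ_κ ⟨A_κ, Δ A_κ⟩`: the operator `Σ_ν ∇_ν^*∇_ν` of passes 4–6 is the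
scalar `Δ` of (1.21) acting on each component. [folklore] -/
theorem form_LapV (c : ℂ) (A : Tor N × Fin d → ℂ) :
    star A ⬝ᵥ (LapV N c *ᵥ A) = ∑ κ, star (comp N A κ) ⬝ᵥ (LapS N c *ᵥ comp N A κ) := by
  rw [LapV, Matrix.sum_mulVec, dotProduct_sum]
  simp_rw [form_gram, nsq_fdiff_mulVec, Complex.ofReal_sum]
  rw [Finset.sum_comm]
  refine Finset.sum_congr rfl fun κ _ => ?_
  rw [LapS, Matrix.sum_mulVec, dotProduct_sum]
  exact Finset.sum_congr rfl fun ν _ => (form_gram _ _).symm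

/-- `⟨A, ∂∂^* A⟩ = ⟨∂*A, ∂*A⟩`. [folklore] -/
theorem form_GradGradH (c : ℂ) (A : Tor N × Fin d → ℂ) :
    star A ⬝ᵥ ((GradOp N c * (GradOp N c)ᴴ) *ᵥ A) = star (divS N c A) ⬝ᵥ divS N c A := by
  have h : GradOp N c * (GradOp N c)ᴴ = ((GradOp N c)ᴴ)ᴴ * (GradOp N c)ᴴ := by
    rw [Matrix.conjTranspose_conjTranspose]
  rw [h, form_gram_rect, GradOp_conjTranspose_mulVec_eq]

/-- **(1.21) as a quadratic form on vector fields**: `½ Σ_{x,μ,ν}|F_{μν}(x)|² =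
⟨A, (Σ_ν ∇_ν^*∇_ν − ∂∂^*) A⟩` — the form of «∂*∂ = Δ − ∂∂*» ((1.69): «Δ = ∂*∂ + ∂∂*») with the
componentwise `Δ = Σ_ν ∇_ν^*∇_ν`. [cite: Balaban1984PropagatorsI, (1.21) p.21] -/
theorem form_curl_eq (c : ℂ) (A : Tor N × Fin d → ℂ) :
    ((((1 / 2 : ℝ) * ∑ x, ∑ μ, ∑ ν, ‖Fs N c A μ ν x‖ ^ 2 : ℝ)) : ℂ)
      = star A ⬝ᵥ ((LapV N c - GradOp N c * (GradOp N c)ᴴ) *ᵥ A) := by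
  rw [action_identity_121, Matrix.sub_mulVec, dotProduct_sub, form_LapV, form_GradGradH]

/-- `Σ_ν ∇_ν^*∇_ν − ∂∂^* ≥ 0` as a quadratic form (it is `½ Σ|F_{μν}|²`). [folklore] -/
theorem form_curl_nonneg (c : ℂ) (A : Tor N × Fin d → ℂ) :
    0 ≤ (star A ⬝ᵥ ((LapV N c - GradOp N c * (GradOp N c)ᴴ) *ᵥ A)).re := by
  rw [← form_curl_eq, Complex.ofReal_re]
  refine mul_nonneg (by norm_num) ?_
  exact Finset.sum_nonneg fun x _ => Finset.sum_nonneg fun μ _ =>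
    Finset.sum_nonneg fun ν _ => by positivity

/-- `∂` from vector functions to plaquette functions («F(p) = (∂A)(p)», (1.2)), indexed by sites
and ORDERED pairs `(μ, ν)` (each plaquette `μ < ν` thus appears twice, with `F_{νμ} = −F_{μν}`).
[cite: Balaban1984PropagatorsI, (1.2) p.18] -/
def CurlOp (c : ℂ) : Matrix (Tor N × (Fin d × Fin d)) (Tor N × Fin d) ℂ :=
  fun i j => (if j.2 = i.2.2 then sdiff N c i.2.1 i.1 j.1 else 0)
    - (if j.2 = i.2.1 then sdiff N c i.2.2 i.1 j.1 else 0)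

/-- `(∂A)(x, (μ, ν)) = F_{μν}(x)`. [cite: Balaban1984PropagatorsI, (1.2) p.18] -/
theorem CurlOp_mulVec (c : ℂ) (A : Tor N × Fin d → ℂ) (x : Tor N) (μ ν : Fin d) :
    (CurlOp N c *ᵥ A) (x, (μ, ν)) = Fs N c A μ ν x := by
  simp only [Matrix.mulVec, dotProduct, CurlOp, Fs, pd, comp, sub_mul, Finset.sum_sub_distrib,
    Fintype.sum_prod_type, ite_mul, zero_mul, Finset.sum_ite_eq', Finset.mem_univ, if_true]

/-- `⟨A, (∂)^*∂ A⟩ = Σ_{x,μ,ν} |F_{μν}(x)|²` for the ordered-pair `∂ = CurlOp`. [folklore] -/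
theorem form_CurlOp (c : ℂ) (A : Tor N × Fin d → ℂ) :
    star A ⬝ᵥ (((CurlOp N c)ᴴ * CurlOp N c) *ᵥ A)
      = ((∑ x, ∑ μ, ∑ ν, ‖Fs N c A μ ν x‖ ^ 2 : ℝ) : ℂ) := by
  rw [form_gram_rect, star_dotProduct_self, nsq, Fintype.sum_prod_type]
  push_cast
  refine Finset.sum_congr rfl fun x _ => ?_
  rw [Fintype.sum_prod_type]
  refine Finset.sum_congr rfl fun μ _ => Finset.sum_congr rfl fun ν _ => ?_
  rw [CurlOp_mulVec]

/-- **«Δ = ∂*∂ + ∂∂*» on vector functions, operator form**: `(CurlOp)^* CurlOp =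
2·(Σ_ν ∇_ν^*∇_ν − ∂∂^*)`.  B5's `∂*` on plaquette functions is the adjoint of `∂` for
`⟨F, F′⟩ = Σ_{p} η^d F(p)F′(p)`, a sum over plaquettes `μ < ν`, i.e. `½ Σ` over ordered pairs
((1.21): «⟨∂A, ∂A⟩ = ½ Σ_{x∈T_η,μ,ν} η^d|F_{μν}(x)|²»); with ordered pairs `(CurlOp)^*CurlOp = 2∂*∂`,
so this is `∂*∂ = Δ − ∂∂*` with `Δ = Σ_ν ∇_ν^*∇_ν` componentwise ((1.69)).
[cite: Balaban1984PropagatorsI, (1.21) p.21] -/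
theorem curl_adjoint_curl (c : ℂ) :
    (CurlOp N c)ᴴ * CurlOp N c = (2 : ℂ) • (LapV N c - GradOp N c * (GradOp N c)ᴴ) := by
  refine ext_of_form_eq fun A => ?_
  rw [form_CurlOp, Matrix.smul_mulVec, dotProduct_smul, ← form_curl_eq, smul_eq_mul]
  push_cast
  ring

variable (n : ℕ) [NeZero n] (M : Fin d → ℕ) [hM : ∀ μ, NeZero (M μ)]

/-- the `Lap` of pass 6 (`B5Prop11Lower`) is `LapV` on the fine torus `T_η`, `η = 1/n`.
[folklore] -/
theorem Lap_eq_LapV : Lap n M = LapV (fine n M) (n : ℂ) := rfl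

/-- hence, for the operator of passes 4–6: `⟨A, Lap A⟩ = Σ_κ ⟨A_κ, Δ A_κ⟩` with `Δ` the scalar
`η`-lattice Laplace operator of (1.21) (`c = η⁻¹ = n`). [cite: Balaban1984PropagatorsI, (1.21) p.21] -/
theorem form_Lap (A : Tor (fine n M) × Fin d → ℂ) :
    star A ⬝ᵥ (Lap n M *ᵥ A)
      = ∑ κ, star (comp (fine n M) A κ) ⬝ᵥ (LapS (fine n M) (n : ℂ) *ᵥ comp (fine n M) A κ) := by
  rw [Lap_eq_LapV, form_LapV]

end Link

end

end Literature.MathematicalPhysics.QuantumFieldTheory.Balaban1983to89.B5Action121
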